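import Summits.HubbardSuperconductivity.HubbardSuperconductivity.Theorems.DeformationLadderLowEnergyRigidityMesoPenalised

/-!
# Route `DeformationLadder`, crux `LowEnergyRigidity` (item `stmt-HubbardSuperconductivity-1892`):
# normal forms of the two hypotheses of the inheritance cut

Companion of `DeformationLadderLowEnergyRigidityInheritance` (`--supports stmt-HubbardSuperconductivity-1892`).
The cut `CondensationGapAt U δ → MesoRigidityAt U δ → LowEnergyRigidity` splits the crux (an `O(1)`
total-energy statement about EVERY low-energy sector state) into two hypotheses; here each is put in
GROUND-ENERGY form, which settles their type:

* `condensationGapAt_iff_mesoPenaltyGap` — (A) is THERMODYNAMIC: it is equivalent to an extensive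
  penalty gap `minEnergyOn (H_L + (τ/R⁴)𝓜_R) K_L − minEnergyOn H_L K_L ≥ θτL²` of the sector ground
  energies of the translation-invariant finite-range family `H_L + (τ/R⁴)𝓜_R` (`𝓜_R = mesoOp L R`,
  `τ > 0` small, `R` fixed) — a statement about energy DENSITIES, to which thermodynamic-limit engines
  (block decompositions, energy-density sandwiches, constructive bounds with `O(L)` boundary errors)
  apply; the every-low-energy-state form (A) then costs nothing (the inheritance lemma);
* `mesoRigidityAt_iff_windowReward` — (B) is an `O(1)` statement: it is equivalent (same constants) to
  `minEnergyOn H_L K_L − γσ ≤ minEnergyOn (H_L − γ·W_R) K_L`, `W_R = 𝓜_R/(L²R⁴) − Δ_dᴴΔ_d/L⁴ ≥ 0` the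
  window-weight operator: rewarding pair weight at nonzero momenta inside the mesoscopic window lowers
  the sector ground energy by at most `γσ = O(1)` — invisible to energy densities, the honest residual.
* `mesoPenaltyGap_iff_penalisedGroundStatesOrdered` — (A′) ⟺ (A″): the extensive gap holds iff every
  normalised sector ground state of the block-penalised model `H_L + (τ'/R⁴)𝓜_R` (some small `τ' > 0`)
  keeps block pair-order density `≥ θ'` — Danskin/Feynman–Hellmann at the mesoscopic level, with the
  sector structure (`preservesSectors_mesoOp`, `exists_unit_groundState_mesoPenalised`) and the a priori
  bound `Re⟨𝓜_R⟩ ≤ 32L²R⁴` of the companion `DeformationLadderLowEnergyRigidityMesoPenalised`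
  (whose `exists_unit_mem_szSector`, with `Telescope.le_minEnergyOn_of_forall_unit`, keeps Mathlib's `sInf` off its
  junk value: `K_L ≠ ⊥` for `-1 ≤ δ`);
* `lowEnergyRigidity_of_penalisedGroundStatesOrdered_of_mesoRigidity` — the cut with (A) in the engine
  form (A″): (A″) ∧ (B) at one `(U, δ)` ⟹ `LowEnergyRigidity`.

Sources: idea card `Cruxes/LowEnergyRigidity/Ideas/condensation-gap-inheritance.md` (2026-08-16);
Tasaki (2020) §2.1 (variational principle); Griffiths, J. Math. Phys. 5 (1964) 1215 (penalised
energies). Folklore linear algebra; no definition is introduced.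
-/

noncomputable section

namespace Summit.HubbardSuperconductivity.HubbardSuperconductivity.Theorems.LowEnergyRigidity

set_option linter.dupNamespace false -- summit = problem name (single-conjunct summit), D-0017

open Matrix
open scoped Matrix.Norms.L2Operator ComplexOrder
open Literature.MathematicalPhysics.QuantumLattice Literature.Probability.LatticeModels
open Summit.HubbardSuperconductivity.HubbardSuperconductivity.Theses.DeformationLadder
open Summit.HubbardSuperconductivity.HubbardSuperconductivity.Theorems
  (minEnergyOn_le_re_rayleigh bddBelow_rayleighSet)

/-! ### Normal forms: (A) is an extensive ground-energy gap, (B) an `O(1)` ground-energy bound -/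

section NormalForms

/-- **(A) is thermodynamic.** For `-1 ≤ δ`, `CondensationGapAt U δ` is EQUIVALENT to an extensive
penalty gap of the sector GROUND ENERGIES of the local Hamiltonian family `H_L + (τ/R⁴)·𝓜_R`:
`∃ θ > 0, R₀, ∀ R ≥ R₀, ∃ τ > 0, L₀, ∀ even L ≥ L₀,
 minEnergyOn H_L K_L + θ τ L² ≤ minEnergyOn (H_L + (τ/R⁴)𝓜_R) K_L`
(`K_L = szSector (2⌊(1-δ)L²/2⌋) 0`). (→): `τ := ε/θ`; a unit sector vector is either
mesoscopically paired (`Re⟨𝓜_R⟩/(L²R⁴) > θ`, penalty `> θτL²` on top of `Re⟨H_L⟩ ≥ E₀`) or pays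
`εL² = θτL²` in `H_L`-energy by (A). (←): the inheritance lemma — `θ' := θ/2`, `ε := θτ/2`: a unit
sector vector with block order `≤ θ/2` has
`E₀ + θτL² ≤ Re⟨H_L⟩ + τL²·(θ/2)`. So (A) is a statement about energy DENSITIES of a
translation-invariant finite-range Hamiltonian (the route's thermodynamic engines apply to it), and
its every-low-energy-state form costs nothing. [folklore] -/
theorem condensationGapAt_iff_mesoPenaltyGap {U δ : ℝ} (hδ : -1 ≤ δ) :
    CondensationGapAt U δ ↔
      ∃ θ : ℝ, 0 < θ ∧ ∃ R₀ : ℕ, ∀ R : ℕ, R₀ ≤ R → ∃ τ : ℝ, 0 < τ ∧ ∃ L₀ : ℕ, ∀ (L : ℕ) [NeZero L],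
        L₀ ≤ L → Even L →
        (hubbardTorus 2 L 1 U).minEnergyOn
              (szSector (Λ := FermionTorus 2 L) (2 * ⌊(1 - δ) * (L : ℝ) ^ 2 / 2⌋₊) 0) +
            θ * τ * (L : ℝ) ^ 2 ≤
          (hubbardTorus 2 L 1 U + (((τ / (R : ℝ) ^ 4 : ℝ) : ℂ)) • mesoOp L R).minEnergyOn
            (szSector (Λ := FermionTorus 2 L) (2 * ⌊(1 - δ) * (L : ℝ) ^ 2 / 2⌋₊) 0) := by
  constructor
  · rintro ⟨θ, hθ, R₀, hA⟩
    refine ⟨θ, hθ, R₀, fun R hR => ?_⟩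
    obtain ⟨ε, hε, L₀, hA⟩ := hA R hR
    refine ⟨ε / θ, by positivity, L₀, fun L _ hL hev => ?_⟩
    have hθτ : θ * (ε / θ) = ε := mul_div_cancel₀ ε hθ.ne'
    rw [hθτ]
    refine Telescope.le_minEnergyOn_of_forall_unit _ _ (exists_unit_mem_szSector L U δ hδ) fun ψ hψK hψ1 => ?_
    rw [add_mulVec, dotProduct_add, Complex.add_re, re_expect_penalisedMeso]
    have hvar := minEnergyOn_le_re_rayleigh (hubbardTorus 2 L 1 U) _ hψK hψ1
    have hpos : 0 ≤ (expect (mesoOp L R) ψ).re / ((L : ℝ) ^ 2 * (R : ℝ) ^ 4) := by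
      refine div_nonneg ?_ (by positivity)
      have h := (posSemidef_mesoOp L R).re_dotProduct_nonneg ψ
      rwa [RCLike.re_to_complex] at h
    rcases le_or_gt ((expect (mesoOp L R) ψ).re / ((L : ℝ) ^ 2 * (R : ℝ) ^ 4)) θ with hle | hgt
    · -- mesoscopically unpaired: (A) charges `ε L²` of `H_L`-energy
      have h1 := hA L hL hev ψ hψK hψ1 hle
      have h2 : 0 ≤ ε / θ * (L : ℝ) ^ 2 *
          ((expect (mesoOp L R) ψ).re / ((L : ℝ) ^ 2 * (R : ℝ) ^ 4)) := by positivity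
      linarith
    · -- mesoscopically paired: the penalty alone exceeds `ε L²`
      have h2 : ε / θ * (L : ℝ) ^ 2 * θ ≤ ε / θ * (L : ℝ) ^ 2 *
          ((expect (mesoOp L R) ψ).re / ((L : ℝ) ^ 2 * (R : ℝ) ^ 4)) :=
        mul_le_mul_of_nonneg_left hgt.le (by positivity)
      have h3 : ε / θ * (L : ℝ) ^ 2 * θ = ε * (L : ℝ) ^ 2 := by
        field_simp
      linarith
  · rintro ⟨θ, hθ, R₀, hA⟩
    refine ⟨θ / 2, by positivity, R₀, fun R hR => ?_⟩
    obtain ⟨τ, hτ, L₀, hA⟩ := hA R hR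
    refine ⟨θ * τ / 2, by positivity, L₀, fun L _ hL hev φ hφK hφ1 hle => ?_⟩
    have hgap := hA L hL hev
    -- the inheritance lemma with `M = mesoOp/R⁴`, `g = θτL²`, read at the state `φ`
    have h1 := minEnergyOn_le_re_rayleigh
      (hubbardTorus 2 L 1 U + (((τ / (R : ℝ) ^ 4 : ℝ) : ℂ)) • mesoOp L R) _ hφK hφ1
    rw [add_mulVec, dotProduct_add, Complex.add_re, re_expect_penalisedMeso] at h1
    have h2 : τ * (L : ℝ) ^ 2 * ((expect (mesoOp L R) φ).re / ((L : ℝ) ^ 2 * (R : ℝ) ^ 4)) ≤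
        τ * (L : ℝ) ^ 2 * (θ / 2) := mul_le_mul_of_nonneg_left hle (by positivity)
    linarith

/-- **(B) is an `O(1)` ground-energy bound.** `MesoRigidityAt U δ` is EQUIVALENT (same constants) to:
rewarding the window weight `W_R = 𝓜_R/(L²R⁴) − Δ_dᴴΔ_d/L⁴` (a bounded non-negative operator,
`lro_le_mesoDensity`) at rate `γ` lowers the sector ground energy by at most `γσ`:
`∀ σ > 0, ∃ R₁, ∀ R ≥ R₁, ∃ γ > 0, L₀, ∀ even L ≥ L₀,
 minEnergyOn H_L K_L − γσ ≤ minEnergyOn (H_L − γ·W_R) K_L` (for `-1 ≤ δ`, so that `K_L ≠ ⊥`).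
Unlike (A) this is invisible to energy densities (`γσ = O(1)`): it is the honest `O(1)` residual of
the crux. [folklore] -/
theorem mesoRigidityAt_iff_windowReward {U δ : ℝ} (hδ : -1 ≤ δ) :
    MesoRigidityAt U δ ↔
      ∀ σ : ℝ, 0 < σ → ∃ R₁ : ℕ, ∀ R : ℕ, R₁ ≤ R → ∃ γ : ℝ, 0 < γ ∧ ∃ L₀ : ℕ, ∀ (L : ℕ) [NeZero L],
        L₀ ≤ L → Even L →
        (hubbardTorus 2 L 1 U).minEnergyOn
              (szSector (Λ := FermionTorus 2 L) (2 * ⌊(1 - δ) * (L : ℝ) ^ 2 / 2⌋₊) 0) - γ * σ ≤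
          (hubbardTorus 2 L 1 U - ((γ : ℝ) : ℂ) •
              ((((1 / ((L : ℝ) ^ 2 * (R : ℝ) ^ 4) : ℝ) : ℂ)) • mesoOp L R -
                (((1 / (L : ℝ) ^ 4 : ℝ) : ℂ)) •
                  ((pairField dWaveFormFactor L)ᴴ * pairField dWaveFormFactor L))).minEnergyOn
            (szSector (Λ := FermionTorus 2 L) (2 * ⌊(1 - δ) * (L : ℝ) ^ 2 / 2⌋₊) 0) := by
  -- the Rayleigh quotient of the rewarded Hamiltonian
  have key : ∀ (L : ℕ) [NeZero L] (R : ℕ) (γ : ℝ) (ψ : Fock (Orb (FermionTorus 2 L))),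
      (star ψ ⬝ᵥ ((hubbardTorus 2 L 1 U - ((γ : ℝ) : ℂ) •
          ((((1 / ((L : ℝ) ^ 2 * (R : ℝ) ^ 4) : ℝ) : ℂ)) • mesoOp L R -
            (((1 / (L : ℝ) ^ 4 : ℝ) : ℂ)) •
              ((pairField dWaveFormFactor L)ᴴ * pairField dWaveFormFactor L))) *ᵥ ψ)).re =
        (star ψ ⬝ᵥ (hubbardTorus 2 L 1 U *ᵥ ψ)).re -
          γ * ((expect (mesoOp L R) ψ).re / ((L : ℝ) ^ 2 * (R : ℝ) ^ 4) -
            (expect ((pairField dWaveFormFactor L)ᴴ * pairField dWaveFormFactor L) ψ).re /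
              (L : ℝ) ^ 4) := by
    intro L _ R γ ψ
    rw [sub_mulVec, dotProduct_sub, Complex.sub_re, smul_mulVec, dotProduct_smul, smul_eq_mul,
      Complex.re_ofReal_mul, sub_mulVec, dotProduct_sub, Complex.sub_re, smul_mulVec,
      dotProduct_smul, smul_eq_mul, Complex.re_ofReal_mul, smul_mulVec, dotProduct_smul,
      smul_eq_mul, Complex.re_ofReal_mul]
    unfold expect
    ring
  constructor
  · intro hB σ hσ
    obtain ⟨R₁, hB⟩ := hB σ hσ
    refine ⟨R₁, fun R hR => ?_⟩
    obtain ⟨γ, hγ, L₀, hB⟩ := hB R hR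
    refine ⟨γ, hγ, L₀, fun L _ hL hev => ?_⟩
    refine Telescope.le_minEnergyOn_of_forall_unit _ _ (exists_unit_mem_szSector L U δ hδ) fun ψ hψK hψ1 => ?_
    rw [key]
    have h := hB L hL hev ψ hψK hψ1
    linarith
  · intro hB σ hσ
    obtain ⟨R₁, hB⟩ := hB σ hσ
    refine ⟨R₁, fun R hR => ?_⟩
    obtain ⟨γ, hγ, L₀, hB⟩ := hB R hR
    refine ⟨γ, hγ, L₀, fun L _ hL hev φ hφK hφ1 => ?_⟩
    have h1 := minEnergyOn_le_re_rayleigh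
      (hubbardTorus 2 L 1 U - ((γ : ℝ) : ℂ) •
          ((((1 / ((L : ℝ) ^ 2 * (R : ℝ) ^ 4) : ℝ) : ℂ)) • mesoOp L R -
            (((1 / (L : ℝ) ^ 4 : ℝ) : ℂ)) •
              ((pairField dWaveFormFactor L)ᴴ * pairField dWaveFormFactor L))) _ hφK hφ1
    rw [key] at h1
    have h2 := hB L hL hev
    linarith

end NormalForms

/-! ### (A′) ⟺ (A″): Danskin form — penalised ground states keep their block order -/

/-- **(A′) ⟺ (A″): the extensive penalty gap is the robustness of the block order of PENALISED
ground states** (Danskin / Feynman–Hellmann at the mesoscopic level, uniformly in `L`; `-1 ≤ δ`).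
The extensive gap `minEnergyOn H_L K_L + θτL² ≤ minEnergyOn (H_L + (τ/R⁴)𝓜_R) K_L` (for some
`τ = τ(R) > 0`, all large even `L`) holds iff, for some `τ' = τ'(R) > 0` and all large even `L`,
EVERY normalised sector ground state of the block-penalised model `H_L + (τ'/R⁴)𝓜_R` has block
pair-order density `≥ θ'` (`θ, θ'` uniform in `R`). (→): `θ₁ := min θ 32`, `τ' := θ₁τ/64`,
`θ' := θ₁/2` — a ground state `ψ` at `τ'` is a trial state at `τ`:
`E₀ + θ₁τL² ≤ E(τ) ≤ E(τ') + (τ−τ')L²·meso(ψ) ≤ E₀ + 32τ'L² + τL²·meso(ψ)`. (←): same `θ, τ` — a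
ground state `ψ_τ` exists (`exists_unit_groundState_mesoPenalised`) and
`E(τ) = Re⟨H_L⟩_{ψ_τ} + τL²·meso(ψ_τ) ≥ E₀ + θτL²`. So (A) says: the mesoscopic `d`-wave pair order
of the ground states survives an infinitesimal EXTENSIVE local pair penalty — the form in which
thermodynamic-limit engines deliver it. Griffiths, J. Math. Phys. 5 (1964) 1215; Kato (1966) II-§5.4.
[folklore] -/
theorem mesoPenaltyGap_iff_penalisedGroundStatesOrdered {U δ : ℝ} (hδ : -1 ≤ δ) :
    (∃ θ : ℝ, 0 < θ ∧ ∃ R₀ : ℕ, ∀ R : ℕ, R₀ ≤ R → ∃ τ : ℝ, 0 < τ ∧ ∃ L₀ : ℕ, ∀ (L : ℕ) [NeZero L],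
        L₀ ≤ L → Even L →
        (hubbardTorus 2 L 1 U).minEnergyOn
              (szSector (Λ := FermionTorus 2 L) (2 * ⌊(1 - δ) * (L : ℝ) ^ 2 / 2⌋₊) 0) +
            θ * τ * (L : ℝ) ^ 2 ≤
          (hubbardTorus 2 L 1 U + (((τ / (R : ℝ) ^ 4 : ℝ) : ℂ)) • mesoOp L R).minEnergyOn
            (szSector (Λ := FermionTorus 2 L) (2 * ⌊(1 - δ) * (L : ℝ) ^ 2 / 2⌋₊) 0)) ↔
      ∃ θ : ℝ, 0 < θ ∧ ∃ R₀ : ℕ, ∀ R : ℕ, R₀ ≤ R → ∃ τ : ℝ, 0 < τ ∧ ∃ L₀ : ℕ, ∀ (L : ℕ) [NeZero L],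
        L₀ ≤ L → Even L →
        ∀ φ : Fock (Orb (FermionTorus 2 L)), star φ ⬝ᵥ φ = 1 →
          IsGroundStateInSector (hubbardTorus 2 L 1 U + (((τ / (R : ℝ) ^ 4 : ℝ) : ℂ)) • mesoOp L R)
            (2 * ⌊(1 - δ) * (L : ℝ) ^ 2 / 2⌋₊) 0 φ →
          θ ≤ (expect (mesoOp L R) φ).re / ((L : ℝ) ^ 2 * (R : ℝ) ^ 4) := by
  constructor
  · rintro ⟨θ, hθ, R₀, hA⟩
    set θ₁ := min θ 32 with hθ₁
    have hθ₁pos : 0 < θ₁ := lt_min hθ (by norm_num)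
    have hθ₁le : θ₁ ≤ θ := min_le_left _ _
    have hθ₁le' : θ₁ ≤ 32 := min_le_right _ _
    refine ⟨θ₁ / 2, by positivity, R₀, fun R hR => ?_⟩
    obtain ⟨τ, hτ, L₀, hA⟩ := hA R hR
    refine ⟨θ₁ * τ / 64, by positivity, L₀, fun L _ hL hev φ hφ1 hgs => ?_⟩
    obtain ⟨hmem, -, heig⟩ := hgs
    have hgap := hA L hL hev
    -- the penalised energy of `φ` at `τ'` is the penalised sector energy `E(τ') ≤ E₀ + 32τ'L²`
    have hEτ' : (star φ ⬝ᵥ (hubbardTorus 2 L 1 U +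
        (((θ₁ * τ / 64 / (R : ℝ) ^ 4 : ℝ) : ℂ)) • mesoOp L R) *ᵥ φ).re ≤
        (hubbardTorus 2 L 1 U).minEnergyOn
            (szSector (Λ := FermionTorus 2 L) (2 * ⌊(1 - δ) * (L : ℝ) ^ 2 / 2⌋₊) 0) +
          32 * (θ₁ * τ / 64) * (L : ℝ) ^ 2 := by
      rw [heig, dotProduct_smul, hφ1, smul_eq_mul, mul_one, Complex.ofReal_re]
      exact minEnergyOn_mesoPenalised_le L R U (by positivity) δ hδ
    rw [add_mulVec, dotProduct_add, Complex.add_re, re_expect_penalisedMeso] at hEτ'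
    -- `φ` as a trial state at `τ`
    have h1 := minEnergyOn_le_re_rayleigh
      (hubbardTorus 2 L 1 U + (((τ / (R : ℝ) ^ 4 : ℝ) : ℂ)) • mesoOp L R) _ hmem hφ1
    rw [add_mulVec, dotProduct_add, Complex.add_re, re_expect_penalisedMeso] at h1
    -- bookkeeping: (τ − τ') L² meso ≥ θ₁τL² − 32τ'L² = θ₁τL²/2, and τ − τ' ≤ τ
    set meso := (expect (mesoOp L R) φ).re / ((L : ℝ) ^ 2 * (R : ℝ) ^ 4) with hmeso
    have hL2 : (0 : ℝ) < (L : ℝ) ^ 2 := by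
      have : (0 : ℝ) < (L : ℝ) := by exact_mod_cast Nat.pos_of_ne_zero (NeZero.ne L)
      positivity
    have hgap' : θ₁ * τ * (L : ℝ) ^ 2 ≤ θ * τ * (L : ℝ) ^ 2 := by gcongr
    have hmeso_nonneg : 0 ≤ meso := by
      refine div_nonneg ?_ (by positivity)
      have h := (posSemidef_mesoOp L R).re_dotProduct_nonneg φ
      rwa [RCLike.re_to_complex] at h
    have hnn : 0 ≤ θ₁ * τ / 64 * (L : ℝ) ^ 2 * meso := by positivity
    have key : θ₁ / 2 * (τ * (L : ℝ) ^ 2) ≤ meso * (τ * (L : ℝ) ^ 2) := by linarith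
    exact le_of_mul_le_mul_right key (by positivity)
  · rintro ⟨θ, hθ, R₀, hA⟩
    refine ⟨θ, hθ, R₀, fun R hR => ?_⟩
    obtain ⟨τ, hτ, L₀, hA⟩ := hA R hR
    refine ⟨τ, hτ, L₀, fun L _ hL hev => ?_⟩
    obtain ⟨φ, hφ1, hgs⟩ := exists_unit_groundState_mesoPenalised L R U (τ / (R : ℝ) ^ 4) δ hδ
    have hθle := hA L hL hev φ hφ1 hgs
    obtain ⟨hmem, -, heig⟩ := hgs
    -- `E(τ) = Re⟨H⟩_φ + τL²·meso(φ) ≥ E₀ + θτL²`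
    have hE : (star φ ⬝ᵥ (hubbardTorus 2 L 1 U +
        (((τ / (R : ℝ) ^ 4 : ℝ) : ℂ)) • mesoOp L R) *ᵥ φ).re =
        (hubbardTorus 2 L 1 U + (((τ / (R : ℝ) ^ 4 : ℝ) : ℂ)) • mesoOp L R).minEnergyOn
          (szSector (Λ := FermionTorus 2 L) (2 * ⌊(1 - δ) * (L : ℝ) ^ 2 / 2⌋₊) 0) := by
      rw [heig, dotProduct_smul, hφ1, smul_eq_mul, mul_one, Complex.ofReal_re]
    rw [add_mulVec, dotProduct_add, Complex.add_re, re_expect_penalisedMeso] at hE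
    have hvar := minEnergyOn_le_re_rayleigh (hubbardTorus 2 L 1 U) _ hmem hφ1
    have h2 : τ * (L : ℝ) ^ 2 * θ ≤
        τ * (L : ℝ) ^ 2 * ((expect (mesoOp L R) φ).re / ((L : ℝ) ^ 2 * (R : ℝ) ^ 4)) :=
      mul_le_mul_of_nonneg_left hθle (by positivity)
    linarith


/-! ### The cut with (A) in engine form -/

/-- **The inheritance cut with its thermodynamic half in Danskin form.** For `0 < U`, `δ ∈ (0,1/2)`:
if (A″) for `R ≥ R₀` some `τ(R) > 0` makes every normalised sector ground state of the block-penalised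
model `H_L + (τ/R⁴)𝓜_R` keep block pair-order density `≥ θ` (all large even `L`; `θ` uniform in `R`),
and (B) `MesoRigidityAt U δ`, then `LowEnergyRigidity`. This is the form in which a thermodynamic-limit
engine (ground states of a translation-invariant finite-range perturbation of `H_L`) feeds the crux:
(A″) ⟹ (A′) ⟹ (A) by `mesoPenaltyGap_iff_penalisedGroundStatesOrdered` and
`condensationGapAt_iff_mesoPenaltyGap`, then `lowEnergyRigidity_of_condensationGap_of_mesoRigidity`.
[folklore] -/
theorem lowEnergyRigidity_of_penalisedGroundStatesOrdered_of_mesoRigidity {U δ : ℝ} (hU : 0 < U)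
    (hδ : δ ∈ Set.Ioo (0 : ℝ) (1 / 2))
    (hA : ∃ θ : ℝ, 0 < θ ∧ ∃ R₀ : ℕ, ∀ R : ℕ, R₀ ≤ R → ∃ τ : ℝ, 0 < τ ∧ ∃ L₀ : ℕ, ∀ (L : ℕ) [NeZero L],
        L₀ ≤ L → Even L →
        ∀ φ : Fock (Orb (FermionTorus 2 L)), star φ ⬝ᵥ φ = 1 →
          IsGroundStateInSector (hubbardTorus 2 L 1 U + (((τ / (R : ℝ) ^ 4 : ℝ) : ℂ)) • mesoOp L R)
            (2 * ⌊(1 - δ) * (L : ℝ) ^ 2 / 2⌋₊) 0 φ →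
          θ ≤ (expect (mesoOp L R) φ).re / ((L : ℝ) ^ 2 * (R : ℝ) ^ 4))
    (hB : MesoRigidityAt U δ) : LowEnergyRigidity :=
  have h1 : (-1 : ℝ) ≤ δ := by linarith [hδ.1]
  lowEnergyRigidity_of_condensationGap_of_mesoRigidity hU hδ
    ((condensationGapAt_iff_mesoPenaltyGap h1).2
      ((mesoPenaltyGap_iff_penalisedGroundStatesOrdered h1).2 hA)) hB

end Summit.HubbardSuperconductivity.HubbardSuperconductivity.Theorems.LowEnergyRigidity
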